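import Summits.Ventures.PercRepro.Benchmarks
import Summits.Ventures.PercRepro.GZ24Final

/-!
# `GZ24Final` holds

Typer-2's named benchmark statement `GZ24Final` (`Benchmarks.lean`, Gladkov–Zimin
arXiv:2404.08873 eq. (final)) is a theorem of the cell: `GZ24Final_holds`, from
`MultiGraph.gz24_final_law3` (`GZ24Final.lean`).
-/

namespace PercRepro

/-- **`GZ24Final` holds**: Gladkov–Zimin's inequality (final), `(B + P3)(T + P1 + P2) ≤ P1 + P2 + P3`,
is a theorem (typer-2's statement, `Benchmarks.lean`; proof `MultiGraph.gz24_final_law3`). -/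
theorem GZ24Final_holds : GZ24Final := fun G p hp a b c _ => G.gz24_final_law3 p hp a b c

end PercRepro
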